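import Literature.Analysis.Complex.SchottkyMontelNormality
import Literature.NumberTheory.Automorphic.ModularLambdaLogGrowth
import HarnessLib

/-!
# Schottky's theorem with a polynomial rate: growth of disc maps omitting `0` and `1`

`Literature/Analysis/Complex/SchottkyQuantitative.lean` — PROOF-ONLY (no definition, no named fact).

Schottky's theorem (F. Schottky 1904; J. B. Conway, *Functions of One Complex Variable I*, GTM 11,
Ch. XII Thm. 2.1; L. V. Ahlfors, *An extension of Schwarz's lemma*, Trans. AMS 43 (1938) §5 for
explicit constants) bounds a holomorphic `f : 𝔻 → ℂ ∖ {0, 1}` in terms of `f(0)` and `|z|` only.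
The tree's `Complex.exists_norm_le_of_mapsTo_compl_zero_one` (file `SchottkyMontelNormality`) is the
qualitative form `‖f z‖ ≤ C(u₀, r)` on `‖z‖ ≤ r`. Here we prove the form with an explicit RATE in
`1 − ‖z‖`, uniformly for `f(0)` in a compact set:

* input: `log ‖λ(τ)‖ ≤ C + π (Im τ + 1/Im τ)` on `ℍ`
  (`Literature.NumberTheory.Automorphic.ModularLambda.exists_log_norm_modularLambda_le`, file
  `ModularLambdaLogGrowth.lean`);
* `exists_forall_mem_image_modularLambda_of_isCompact` — a compact `K ⊆ ℂ ∖ {0, 1}` is the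
  `λ`-image of a set `{y₀ ≤ Im τ, ‖τ‖ ≤ R₀}` (compactness + the open mapping and surjectivity of
  `λ : ℍ → ℂ ∖ {0,1}` from the tree);
* ★ `exists_log_norm_le_of_mapsTo_compl_zero_one_of_isCompact` — **quantitative Schottky**: for every
  compact `K ⊆ ℂ ∖ {0, 1}` there are `C ≥ 0` and `n : ℕ` with
  `log ‖f z‖ ≤ C / (1 − ‖z‖)ⁿ` for all `z ∈ 𝔻` and every `f` holomorphic on `𝔻` omitting `0` and `1`
  with `f 0 ∈ K`.

Proof of ★ (the classical one through the elliptic modular function, as in the tree's qualitative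
version, made quantitative): lift `f` through `λ` to `F : 𝔻 → ℍ` with `F 0 = τ₀`, `λ τ₀ = f 0`,
`Im τ₀ ≥ y₀`, `‖τ₀‖ ≤ R₀` (`Complex.exists_differentiableOn_lift_modularLambda_ball`); the Schwarz
lemma for the Cayley transform `(F − τ₀)/(F − τ̄₀) : 𝔻 → 𝔻` confines `F z` to
`‖F z − τ₀‖ ≤ 2‖z‖ Im τ₀/(1 − ‖z‖)`, `Im F z ≥ (1 − ‖z‖²) Im τ₀/4`; then the growth bound of `λ` gives
`log ‖f z‖ = log ‖λ(F z)‖ ≤ C + π(Im F z + 1/Im F z) ≤ C'/(1 − ‖z‖)`.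

Consumer: the unconditional form of Calegari–Dimitrov–Tang's Theorem 6.0.1 (mean growth of disc maps
omitting the `N`-th roots of unity), file `OmittedRootsOfUnityMeanGrowth.lean`.

## References
* [Conway1978] J. B. Conway, *Functions of One Complex Variable I*, GTM 11, Ch. XII Thm. 2.1.
* [Ahlfors1979] L. V. Ahlfors, *Complex Analysis*, 3rd ed. (1979), Ch. 7 §3.4 (the `λ` function).
* [CalegariDimitrovTang2025] F. Calegari, V. Dimitrov, Y. Tang, J. Amer. Math. Soc. 38 (2025),
  Lemma 5.3.5 and Theorem 6.0.1 (the consumer).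
-/

noncomputable section

open Set Metric Filter
open scoped Topology Real UpperHalfPlane MatrixGroups

namespace Literature.Analysis.Complex

open _root_.Complex Literature.NumberTheory.Automorphic Literature.NumberTheory.Automorphic.ModularLambda

/-! ### 1. Compact sets of values are attained in a compact part of `ℍ` -/

/-- **Uniform preimages under `λ` for a compact set of values.** For a compact `K ⊆ ℂ ∖ {0, 1}`
there are `y₀ > 0` and `R₀` such that every `u ∈ K` is `λ(τ)` for some `τ` with `Im τ ≥ y₀` and
`‖τ‖ ≤ R₀` (the images `λ({1/(m+1) < Im τ, ‖τ‖ < m+1})`, `m ∈ ℕ`, form an increasing open cover of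
`ℂ ∖ {0,1}`). [folklore] -/
private theorem exists_forall_mem_image_modularLambda_of_isCompact {K : Set ℂ} (hK : IsCompact K)
    (hK01 : ∀ u ∈ K, u ≠ 0 ∧ u ≠ 1) :
    ∃ y₀ R₀ : ℝ, 0 < y₀ ∧ ∀ u ∈ K, ∃ τ : ℂ, y₀ ≤ τ.im ∧ ‖τ‖ ≤ R₀ ∧ modularLambda τ = u := by
  -- the increasing family of open sets
  set S : ℕ → Set ℂ := fun m ↦ {τ : ℂ | (1 : ℝ) / (m + 1) < τ.im ∧ ‖τ‖ < m + 1} with hS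
  have hSopen : ∀ m, IsOpen (S m) := fun m ↦
    (isOpen_lt continuous_const Complex.continuous_im).inter
      (isOpen_lt continuous_norm continuous_const)
  have hSsub : ∀ m, S m ⊆ {z : ℂ | 0 < z.im} := fun m τ hτ ↦
    lt_trans (by positivity) hτ.1
  set U : ℕ → Set ℂ := fun m ↦ modularLambda '' S m with hU
  have hUopen : ∀ m, IsOpen (U m) := fun m ↦ isOpen_image_modularLambda (hSsub m) (hSopen m)
  -- monotonicity of the family
  have hSmono : ∀ {m m' : ℕ}, m ≤ m' → S m ⊆ S m' := by
    intro m m' hmm' τ hτ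
    have hcast : (m : ℝ) ≤ m' := by exact_mod_cast hmm'
    refine ⟨lt_of_le_of_lt ?_ hτ.1, lt_of_lt_of_le hτ.2 (by linarith)⟩
    exact one_div_le_one_div_of_le (by positivity) (by linarith)
  have hUmono : ∀ {m m' : ℕ}, m ≤ m' → U m ⊆ U m' := fun hmm' ↦ image_mono (hSmono hmm')
  -- the family covers `K`
  have hcover : K ⊆ ⋃ m, U m := by
    intro u hu
    obtain ⟨τ, hτ, hτu⟩ := exists_modularLambda_eq (hK01 u hu).1 (hK01 u hu).2
    obtain ⟨m, hm⟩ := exists_nat_gt (max τ.im⁻¹ ‖τ‖)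
    have hm1 : τ.im⁻¹ < m + 1 := by linarith [le_max_left τ.im⁻¹ ‖τ‖]
    have hm2 : ‖τ‖ < m + 1 := by linarith [le_max_right τ.im⁻¹ ‖τ‖]
    refine mem_iUnion.2 ⟨m, ⟨τ, ⟨?_, hm2⟩, hτu⟩⟩
    rw [div_lt_iff₀ (by positivity)]
    have := (inv_lt_iff_one_lt_mul₀ hτ).1 hm1
    linarith
  obtain ⟨t, ht⟩ := hK.elim_finite_subcover U hUopen hcover
  -- a single index suffices
  set m₀ : ℕ := t.sup id with hm₀
  have hKU : K ⊆ U m₀ := by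
    intro u hu
    obtain ⟨m, hm, hum⟩ := mem_iUnion₂.1 (ht hu)
    exact hUmono (Finset.le_sup (f := id) hm) hum
  refine ⟨1 / (m₀ + 1), m₀ + 1, by positivity, fun u hu ↦ ?_⟩
  obtain ⟨τ, hτS, hτu⟩ := hKU hu
  exact ⟨τ, hτS.1.le, hτS.2.le, hτu⟩

/-! ### 2. The Cayley transform at `τ₀` and the confinement of the lift (Schwarz–Pick) -/

/-- `|τ − τ̄₀|² = |τ − τ₀|² + 4·Im τ·Im τ₀`. [folklore] -/
private theorem normSq_sub_conj_eq_normSq_sub_add (τ τ₀ : ℂ) :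
    normSq (τ - (starRingEnd ℂ) τ₀) = normSq (τ - τ₀) + 4 * τ.im * τ₀.im := by
  simp only [normSq_apply, sub_re, sub_im, conj_re, conj_im]
  ring

/-- For `Im τ > 0`, `Im τ₀ > 0`: `τ ≠ τ̄₀`. [folklore] -/
private theorem sub_conj_ne_zero_of_im_pos {τ τ₀ : ℂ} (hτ : 0 < τ.im) (hτ₀ : 0 < τ₀.im) :
    τ - (starRingEnd ℂ) τ₀ ≠ 0 := by
  intro h
  have := congrArg Complex.im h
  simp only [sub_im, conj_im, zero_im] at this
  linarith

/-- The Cayley transform `(τ − τ₀)/(τ − τ̄₀)` maps the upper half-plane into the open unit disc.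
[folklore] -/
private theorem norm_cayley_sub_lt_one {τ τ₀ : ℂ} (hτ : 0 < τ.im) (hτ₀ : 0 < τ₀.im) :
    ‖(τ - τ₀) / (τ - (starRingEnd ℂ) τ₀)‖ < 1 := by
  have hne := sub_conj_ne_zero_of_im_pos hτ hτ₀
  rw [norm_div, div_lt_one (norm_pos_iff.2 hne)]
  have h1 : normSq (τ - τ₀) < normSq (τ - (starRingEnd ℂ) τ₀) := by
    rw [normSq_sub_conj_eq_normSq_sub_add]; nlinarith
  have h2 : ‖τ - τ₀‖ ^ 2 < ‖τ - (starRingEnd ℂ) τ₀‖ ^ 2 := by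
    rwa [← normSq_eq_norm_sq, ← normSq_eq_norm_sq]
  exact lt_of_pow_lt_pow_left₀ 2 (norm_nonneg _) h2

/-- **Confinement by the Schwarz lemma.** If `|τ − τ₀| ≤ r·|τ − τ̄₀|` with `0 ≤ r < 1` and
`Im τ, Im τ₀ > 0`, then `|τ − τ₀| ≤ 2r·Im τ₀/(1 − r)` and `Im τ ≥ (1 − r²)·Im τ₀/4`. [folklore] -/
private theorem norm_sub_le_and_le_im_of_cayley_le {τ τ₀ : ℂ} {r : ℝ} (hτ : 0 < τ.im) (hτ₀ : 0 < τ₀.im)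
    (hr0 : 0 ≤ r) (hr : r < 1) (h : ‖τ - τ₀‖ ≤ r * ‖τ - (starRingEnd ℂ) τ₀‖) :
    ‖τ - τ₀‖ ≤ 2 * r * τ₀.im / (1 - r) ∧ (1 - r ^ 2) * τ₀.im / 4 ≤ τ.im := by
  have hconj : ‖τ₀ - (starRingEnd ℂ) τ₀‖ = 2 * τ₀.im := by
    have : τ₀ - (starRingEnd ℂ) τ₀ = ((2 * τ₀.im : ℝ) : ℂ) * I := by
      apply Complex.ext
      · simp [sub_re, conj_re]
      · simp [sub_im, conj_im]; ring
    rw [this, norm_mul, norm_I, mul_one, norm_real, Real.norm_eq_abs, abs_of_pos (by positivity)]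
  constructor
  · have htri : ‖τ - (starRingEnd ℂ) τ₀‖ ≤ ‖τ - τ₀‖ + 2 * τ₀.im := by
      rw [← hconj]
      have : τ - (starRingEnd ℂ) τ₀ = (τ - τ₀) + (τ₀ - (starRingEnd ℂ) τ₀) := by ring
      rw [this]
      exact norm_add_le _ _
    have h1r : 0 < 1 - r := by linarith
    rw [le_div_iff₀ h1r]
    nlinarith [norm_nonneg (τ - τ₀)]
  · have hsq : ‖τ - τ₀‖ ^ 2 ≤ r ^ 2 * ‖τ - (starRingEnd ℂ) τ₀‖ ^ 2 := by
      rw [← mul_pow]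
      exact pow_le_pow_left₀ (norm_nonneg _) h 2
    rw [← normSq_eq_norm_sq, ← normSq_eq_norm_sq, normSq_sub_conj_eq_normSq_sub_add] at hsq
    have hlow : τ₀.im ^ 2 ≤ normSq (τ - τ₀) + 4 * τ.im * τ₀.im := by
      rw [← normSq_sub_conj_eq_normSq_sub_add, normSq_apply, sub_im, conj_im]
      nlinarith [mul_self_nonneg ((τ - (starRingEnd ℂ) τ₀).re)]
    have hns : 0 ≤ normSq (τ - τ₀) := normSq_nonneg _
    nlinarith [mul_pos hτ hτ₀, sq_nonneg r]

/-- **Confinement of a `λ`-lift.** If `F` is holomorphic on the unit disc with values in the upper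
half-plane and `F 0 = τ₀`, then for `z` in the disc: `‖F z − τ₀‖ ≤ 2‖z‖ Im τ₀/(1 − ‖z‖)` and
`Im (F z) ≥ (1 − ‖z‖²) Im τ₀ / 4` (Schwarz's lemma for the Cayley transform of `F`; the confinement step of
the proof of Schottky's theorem). [cite: Conway1978, Ch. XII Thm. 2.1] -/
theorem norm_sub_le_and_le_im_of_mapsTo_upperHalfPlane {F : ℂ → ℂ}
    (hFd : DifferentiableOn ℂ F (ball (0 : ℂ) 1)) (hFim : ∀ z ∈ ball (0 : ℂ) 1, 0 < (F z).im)
    {τ₀ : ℂ} (hF0 : F 0 = τ₀) {z : ℂ} (hz : z ∈ ball (0 : ℂ) 1) :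
    ‖F z - τ₀‖ ≤ 2 * ‖z‖ * τ₀.im / (1 - ‖z‖) ∧ (1 - ‖z‖ ^ 2) * τ₀.im / 4 ≤ (F z).im := by
  have hτ₀ : 0 < τ₀.im := by rw [← hF0]; exact hFim 0 (mem_ball_self one_pos)
  set h : ℂ → ℂ := fun w ↦ (F w - τ₀) / (F w - (starRingEnd ℂ) τ₀) with hh
  have hhd : DifferentiableOn ℂ h (ball (0 : ℂ) 1) := by
    intro w hw
    have hF := hFd w hw
    exact (hF.sub (differentiableWithinAt_const _)).div (hF.sub (differentiableWithinAt_const _))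
      (sub_conj_ne_zero_of_im_pos (hFim w hw) hτ₀)
  have hmaps : MapsTo h (ball (0 : ℂ) 1) (closedBall (0 : ℂ) 1) := fun w hw ↦
    mem_closedBall_zero_iff.2 (norm_cayley_sub_lt_one (hFim w hw) hτ₀).le
  have hh0 : h 0 = 0 := by simp [hh, hF0]
  have hz1 : ‖z‖ < 1 := mem_ball_zero_iff.1 hz
  have hSchwarz : ‖h z‖ ≤ ‖z‖ := norm_le_norm_of_mapsTo_ball hhd hmaps hh0 hz1
  have hne := sub_conj_ne_zero_of_im_pos (hFim z hz) hτ₀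
  have hineq : ‖F z - τ₀‖ ≤ ‖z‖ * ‖F z - (starRingEnd ℂ) τ₀‖ := by
    have h1 := hSchwarz
    rw [hh, norm_div, div_le_iff₀ (norm_pos_iff.2 hne)] at h1
    exact h1
  exact norm_sub_le_and_le_im_of_cayley_le (hFim z hz) hτ₀ (norm_nonneg z) hz1 hineq

/-! ### 3. Quantitative Schottky -/

/-- ★ **Schottky's theorem with a polynomial rate, uniformly over a compact set of base values.**
For every compact `K ⊆ ℂ ∖ {0, 1}` there are `C ≥ 0` and `n : ℕ` such that every `f` holomorphic on
the open unit disc, omitting the values `0` and `1` there, with `f 0 ∈ K`, satisfies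
`log ‖f z‖ ≤ C / (1 − ‖z‖)ⁿ` for all `‖z‖ < 1` (we obtain `n = 1`, the classical rate; the
exponent is kept existential for the consumers). [cite: Conway1978, Ch. XII Thm. 2.1] -/
theorem exists_log_norm_le_of_mapsTo_compl_zero_one_of_isCompact {K : Set ℂ} (hK : IsCompact K)
    (hK01 : ∀ u ∈ K, u ≠ 0 ∧ u ≠ 1) :
    ∃ (C : ℝ) (n : ℕ), 0 ≤ C ∧ ∀ f : ℂ → ℂ, DifferentiableOn ℂ f (ball (0 : ℂ) 1) →
      (∀ z ∈ ball (0 : ℂ) 1, f z ≠ 0 ∧ f z ≠ 1) → f 0 ∈ K →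
      ∀ z ∈ ball (0 : ℂ) 1, Real.log ‖f z‖ ≤ C / (1 - ‖z‖) ^ n := by
  obtain ⟨y₀, R₀, hy₀, hKlam⟩ := exists_forall_mem_image_modularLambda_of_isCompact hK hK01
  obtain ⟨C, hlam⟩ := exists_log_norm_modularLambda_le
  -- constants: `R₁ = max R₀ 0 ≥ 0`
  set R₁ : ℝ := max R₀ 0 with hR₁
  have hR₁0 : 0 ≤ R₁ := le_max_right _ _
  refine ⟨|C| + π * (3 * R₁ + 4 / y₀), 1, by positivity, fun f hf h01 hf0 z hz ↦ ?_⟩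
  obtain ⟨τ₀, hτ₀y, hτ₀R, hτ₀u⟩ := hKlam (f 0) hf0
  have hτ₀ : 0 < τ₀.im := lt_of_lt_of_le hy₀ hτ₀y
  have hτ₀R₁ : ‖τ₀‖ ≤ R₁ := hτ₀R.trans (le_max_left _ _)
  obtain ⟨F, hFd, hFim, hF0, hFlam⟩ :=
    Complex.exists_differentiableOn_lift_modularLambda_ball hf h01 hτ₀ hτ₀u
  obtain ⟨hsub, him⟩ := norm_sub_le_and_le_im_of_mapsTo_upperHalfPlane hFd hFim hF0 hz
  have hz1 : ‖z‖ < 1 := mem_ball_zero_iff.1 hz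
  have h1z : 0 < 1 - ‖z‖ := by linarith
  have hFz : 0 < (F z).im := hFim z hz
  -- `Im (F z) ≤ ‖F z‖ ≤ 3 R₁ / (1 - ‖z‖)`
  have hup : (F z).im ≤ 3 * R₁ / (1 - ‖z‖) := by
    have hτle : ‖F z‖ ≤ ‖τ₀‖ + ‖F z - τ₀‖ := by
      have := norm_add_le τ₀ (F z - τ₀)
      rwa [add_sub_cancel] at this
    have hτ₀im : τ₀.im ≤ R₁ := (Complex.im_le_norm τ₀).trans hτ₀R₁
    have h2 : ‖F z - τ₀‖ ≤ 2 * R₁ / (1 - ‖z‖) := by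
      refine hsub.trans (div_le_div_of_nonneg_right ?_ h1z.le)
      nlinarith [norm_nonneg z]
    have h3 : ‖τ₀‖ ≤ R₁ / (1 - ‖z‖) := by
      rw [le_div_iff₀ h1z]; nlinarith [norm_nonneg z]
    calc (F z).im ≤ ‖F z‖ := Complex.im_le_norm _
      _ ≤ R₁ / (1 - ‖z‖) + 2 * R₁ / (1 - ‖z‖) := by linarith
      _ = 3 * R₁ / (1 - ‖z‖) := by ring
  -- `1 / Im (F z) ≤ 4 / (y₀ (1 - ‖z‖))`
  have hlow : (F z).im⁻¹ ≤ 4 / y₀ / (1 - ‖z‖) := by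
    have him' : (1 - ‖z‖) * y₀ / 4 ≤ (F z).im := by
      have : (1 - ‖z‖) * y₀ ≤ (1 - ‖z‖ ^ 2) * τ₀.im := by
        have h1 : 1 - ‖z‖ ≤ 1 - ‖z‖ ^ 2 := by nlinarith [norm_nonneg z]
        exact mul_le_mul h1 hτ₀y hy₀.le (by nlinarith [norm_nonneg z])
      linarith
    rw [inv_le_comm₀ hFz (by positivity)]
    calc (4 / y₀ / (1 - ‖z‖))⁻¹ = (1 - ‖z‖) * y₀ / 4 := by
          field_simp
      _ ≤ (F z).im := him'
  rw [← hFlam z hz, pow_one]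
  calc Real.log ‖modularLambda (F z)‖ ≤ C + π * ((F z).im + (F z).im⁻¹) := hlam (F z) hFz
    _ ≤ |C| / (1 - ‖z‖) + π * (3 * R₁ / (1 - ‖z‖) + 4 / y₀ / (1 - ‖z‖)) := by
        have hC : C ≤ |C| / (1 - ‖z‖) := by
          rw [le_div_iff₀ h1z]
          nlinarith [le_abs_self C, abs_nonneg C, norm_nonneg z]
        gcongr
    _ = (|C| + π * (3 * R₁ + 4 / y₀)) / (1 - ‖z‖) := by
        field_simp

end Literature.Analysis.Complex

end
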